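import Summits.AtomisticToContinuum.HydrodynamicLimit.Theorems.JParityClosureOddContactSymmetryGibbsInvariance
import Summits.AtomisticToContinuum.HydrodynamicLimit.Theorems.JParityClosureOddContactSymmetrySlabShiftDecomp
import Summits.AtomisticToContinuum.HydrodynamicLimit.Theorems.JParityClosureOddContactSymmetryCollisionPairSumMeasurable
import Summits.AtomisticToContinuum.HydrodynamicLimit.Theorems.JParityClosureOddContactSymmetryMetroMarkRegular
import Summits.AtomisticToContinuum.HydrodynamicLimit.Theorems.JParityClosureOddContactSymmetryHoelderChernoff
import Summits.AtomisticToContinuum.HydrodynamicLimit.Theorems.JParityClosureOddContactSymmetryTimeZeroNull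
import Literature.Analysis.FluidPDE.HardSphereCollisionRecord
import Literature.MathematicalPhysics.KineticTheory.HardSphereEulerProofs
import Literature.MathematicalPhysics.KineticTheory.MetropolisOddStatistic
import HarnessLib

/-!
# The full-window equilibrium rate of the Metropolis-odd statistic from the kinetic-slab pressure bet (line `KineticSlabSketch`)

Crux `JParityClosure.OddContactSymmetry` (stmt-AtomisticToContinuum-17722, rev 5), line `KineticSlabSketch` (card
`kinetic-slab-entropy-spending`), lead `prover-line-stmt-AtomisticToContinuum-17722-0`.  CONDITIONAL form of step 1 of the
registered skeleton `Cruxes/OddContactSymmetry/Lines/KineticSlabSketch.lean`: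

* `windowRate_of_slabPressure (hS1 : S1)` — under the flow-invariant homogeneous Gibbs law `G_N = localGibbsLaw σ 1 0 θe`,
  `G_N{x < |D_{r_K}|} ≤ e^{-M(N+1)}` for every `M`, `K ≥ K₀(x, M)`, `D_{r_K}` the Metropolis-odd statistic `metroOddStat` read
  at the kinetic mesoscale `r_K = K^{1/4}(N+1)^{-1/3}`.  Hypothesis S1 = the line's registered open stub `stub_slabPressure`
  VERBATIM (one-slab exponential moments at per-particle tilt, uniformly over time-shifts of the weight, slab lengths in
  `[K t_N/2, K t_N]` and tilts in `[b/2, b]`).  Proof: the window `[0, τ]` is `W = ⌈τ/(K t_N)⌉` shifted slabs of length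
  `τ/W` (LANDED S2 `stub_slabShiftDecomp` p135469, S5 `stub_timeZeroNull` p137154 for closed vs half-open), the slab functionals
  are a.e.-measurable (S3 `stub_collisionPairSumMeasurable` p136068 + S3b `stub_metroMarkRegular` p136674), and Hölder over the
  `G_N`-preserving shifts `Φ_{wℓ}` (`measurePreserving_flow_localGibbsLaw_const`) + Chernoff (S4 `stub_hoelderChernoff`
  p136845) at tilt `b = 2M/x`, level `y = x/(4στ)`.
-/

noncomputable section

open scoped BigOperators Classical InnerProductSpace ENNReal Topology
open Set MeasureTheory Filter
open Literature.Analysis.FluidPDE Literature.MathematicalPhysics.KineticTheory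

namespace Summit.AtomisticToContinuum.HydrodynamicLimit.Theorems.OddContactSymmetryKineticSlab

/-! ## Vocabulary

The statistic is named in `Literature/MathematicalPhysics/KineticTheory/MetropolisOddStatistic.lean` (p134645):
`metroOddMark`, `metroOddSum` (window `S`, inline form), `metroOddStat` (verbatim crux `let`-chain),
`metroOddStat_eq` (rfl factorisation), `metroOddSum_eq_collisionPairSum_of_mem_good`, `abs_metroOddMark_le`. -/

/-! ## Composition, step 1: the full-window equilibrium rate from the slab bet -/

/-- **`windowRate_of_slabPressure`** — the full-window equilibrium large-deviation bound at the kinetic mesoscale: under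
`G_N = localGibbsLaw σ 1 0 θe`, for every deviation `x > 0` and rate `M > 0`, for `K ≥ K₀(x, M, …)` and all
large `N`, `G_N{x < |D_{r_K}|} ≤ e^{-M(N+1)}`, `D_{r_K}` the crux statistic read at `r_K = K^{1/4}(N+1)^{-1/3}`.
From S1 (slab pressure at tilt `2M/x · 2στ`, level `x/(4στ)`), S2 (the window `[0, τ]` is `W = ⌈τ/(K t_N)⌉`
shifted slabs of length `τ/W ∈ [K t_N/2, K t_N]`), S3/S3b (measurability), S4 (Hölder over the `G_N`-preserving
shifts `Φ_{wℓ}` + Chernoff) and S5 (closed versus half-open window). [folklore] -/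
theorem windowRate_of_slabPressure : (∃ η₀ : ℝ, 0 < η₀ ∧ ∀ θe : ℝ, 0 < θe → ∃ σ₀ : ℝ, 0 < σ₀ ∧ ∀ σ : ℝ, 0 < σ → σ < σ₀ → ∀ Φ : (N : ℕ) → HardSphereFlow (Torus.geometry (Fin 3)) (hsDiameter σ N) (N + 1), ∀ τ : ℝ, 0 < τ → ∀ χ : ℝ × UnitAddTorus (Fin 3) → ℝ, Continuous χ → ∀ g : ℝ → ℝ, Continuous g → (∀ a, η₀ ≤ a → g a = 0) → ∀ Ψ : V3 × V3 × V3 → ℝ, Continuous Ψ → (∃ C : ℝ, ∀ q, |Ψ q| ≤ C) → (∀ (n v w : V3), ‖n‖ = 1 → Ψ (-n, (reflectVel n (v, w)).1, (reflectVel n (v, w)).2) = -Ψ (n, v, w)) → ∀ ϑ : ℝ, 0 < ϑ → ∀ b y : ℝ, 0 < b → 0 < y → ∃ K₀ : ℕ, ∀ K : ℕ, K₀ ≤ K → ∃ N₀ : ℕ, ∀ N : ℕ, N₀ ≤ N → ∀ s ∈ Set.Icc (0 : ℝ) τ, ∀ ℓ : ℝ, (K : ℝ) * ((N + 1 : ℕ)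 : ℝ) ^ (-(1 / 3 : ℝ)) / 2 ≤ ℓ → ℓ ≤ (K : ℝ) * ((N + 1 : ℕ) : ℝ) ^ (-(1 / 3 : ℝ)) → ∀ b' : ℝ, b / 2 ≤ b' → b' ≤ b → ∫⁻ z, ENNReal.ofReal (Real.exp (b' / K * |metroOddSum σ N (Φ N) (Set.Ioc 0 ℓ) (fun p => χ (p.1 + s, p.2)) g Ψ ((K : ℝ) ^ (1 / 4 : ℝ) * ((N + 1 : ℕ) : ℝ) ^ (-(1 / 3 : ℝ))) ϑ z|)) ∂(localGibbsLaw σ (fun _ => 1) (fun _ => 0) (fun _ => θe) N (Φ N)) ≤ ENNReal.ofReal (Real.exp (b' * y * ((N : ℝ) + 1)))) → ∃ η₀ : ℝ, 0 < η₀ ∧ ∀ θe : ℝ, 0 < θe → ∃ σ₀ : ℝ, 0 < σ₀ ∧ ∀ σ : ℝ, 0 < σ → σ < σ₀ → ∀ Φ : (N : ℕ) → HardSphereFlow (Torus.geometry (Fin 3)) (hsDiameter σ N) (N + 1), ∀ τ : ℝ, 0 < τ → ∀ χ : ℝ × UnitAddTorus (Fin 3) → ℝ, Continuous χ → ∀ g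 : ℝ → ℝ, Continuous g → (∀ a, η₀ ≤ a → g a = 0) → ∀ Ψ : V3 × V3 × V3 → ℝ, Continuous Ψ → (∃ C : ℝ, ∀ q, |Ψ q| ≤ C) → (∀ (n v w : V3), ‖n‖ = 1 → Ψ (-n, (reflectVel n (v, w)).1, (reflectVel n (v, w)).2) = -Ψ (n, v, w)) → ∀ ϑ : ℝ, 0 < ϑ → ∀ x M : ℝ, 0 < x → 0 < M → ∃ K₀ : ℕ, ∀ K : ℕ, K₀ ≤ K → ∃ N₀ : ℕ, ∀ N : ℕ, N₀ ≤ N → localGibbsLaw σ (fun _ => 1) (fun _ => 0) (fun _ => θe) N (Φ N) {z | x < |metroOddStat σ N (Φ N) τ χ g Ψ ((K : ℝ) ^ (1 / 4 : ℝ) * ((N + 1 : ℕ) : ℝ) ^ (-(1 / 3 : ℝ))) ϑ z|} ≤ ENNReal.ofReal (Real.exp (-(M * ((N : ℝ) + 1)))) := by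
  intro hS1
  obtain ⟨η₀, hη₀, hS1⟩ := hS1
  refine ⟨η₀, hη₀, fun θe hθe => ?_⟩
  obtain ⟨σ₁, hσ₁, hS1'⟩ := hS1 θe hθe
  refine ⟨min σ₁ 4⁻¹, lt_min hσ₁ (by norm_num), ?_⟩
  intro σ hσ hσlt Φ τ hτ χ hχ g hg hg0 Ψ hΨ hΨb hΨodd ϑ hϑ x M hx hM
  have hσ₁' : σ < σ₁ := hσlt.trans_le (min_le_left _ _)
  have hσ4 : σ < 4⁻¹ := hσlt.trans_le (min_le_right _ _)
  have hσ2 : σ < 2⁻¹ := hσ4.trans (by norm_num)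
  -- constants: per-particle tilt `b`, slab tilt band top `bb`, level `y`
  set b : ℝ := 2 * M / x with hb_def
  have hb : 0 < b := by positivity
  set bb : ℝ := 2 * b * σ * τ with hbb_def
  have hbb : 0 < bb := by positivity
  set y : ℝ := x / (4 * σ * τ) with hy_def
  have hy : 0 < y := by positivity
  obtain ⟨K₀, hK₀⟩ := hS1' σ hσ hσ₁' Φ τ hτ χ hχ g hg hg0 Ψ hΨ hΨb hΨodd ϑ hϑ bb y hbb hy
  refine ⟨max K₀ 1, fun K hK => ?_⟩
  have hK0 : K₀ ≤ K := (le_max_left _ _).trans hK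
  have hK1 : 1 ≤ K := (le_max_right _ _).trans hK
  have hKpos : (0 : ℝ) < K := by exact_mod_cast hK1
  obtain ⟨N₀, hN₀⟩ := hK₀ K hK0
  -- `K t_N ≤ τ` eventually
  obtain ⟨N₁, hN₁⟩ : ∃ N₁ : ℕ, ∀ N : ℕ, N₁ ≤ N →
      (K : ℝ) * ((N + 1 : ℕ) : ℝ) ^ (-(1 / 3 : ℝ)) ≤ τ := by
    have h1 : Tendsto (fun N : ℕ => ((N + 1 : ℕ) : ℝ)) atTop atTop :=
      tendsto_natCast_atTop_atTop.comp (tendsto_add_atTop_nat 1)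
    have h2 : Tendsto (fun N : ℕ => ((N + 1 : ℕ) : ℝ) ^ (-(1 / 3 : ℝ))) atTop (𝓝 0) :=
      (tendsto_rpow_neg_atTop (by norm_num : (0 : ℝ) < 1 / 3)).comp h1
    have h3 : Tendsto (fun N : ℕ => (K : ℝ) * ((N + 1 : ℕ) : ℝ) ^ (-(1 / 3 : ℝ))) atTop (𝓝 0) := by
      simpa using h2.const_mul (K : ℝ)
    obtain ⟨N₁, hN₁⟩ := eventually_atTop.1 (h3.eventually (Iic_mem_nhds hτ))
    exact ⟨N₁, fun N hN => hN₁ N hN⟩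
  refine ⟨max N₀ N₁, fun N hN => ?_⟩
  have hN₀' : N₀ ≤ N := (le_max_left _ _).trans hN
  have hN₁' : N₁ ≤ N := (le_max_right _ _).trans hN
  -- notation
  set tN : ℝ := ((N + 1 : ℕ) : ℝ) ^ (-(1 / 3 : ℝ)) with htN_def
  set rKN : ℝ := (K : ℝ) ^ (1 / 4 : ℝ) * tN with hrKN_def
  set ε : ℝ := hsDiameter σ N with hε_def
  have hε : ε = σ * tN := rfl
  have htN : 0 < tN := Real.rpow_pos_of_pos (by positivity) _
  have hε0 : 0 < ε := hsDiameter_pos hσ N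
  have hε2 : ε < 2⁻¹ := (hsDiameter_le hσ.le N).trans_lt hσ2
  have hrKN : 0 < rKN := mul_pos (Real.rpow_pos_of_pos hKpos _) htN
  have hN1 : (0 : ℝ) < (N : ℝ) + 1 := by positivity
  have hKt : 0 < (K : ℝ) * tN := mul_pos hKpos htN
  have hKtτ : (K : ℝ) * tN ≤ τ := hN₁ N hN₁'
  set G := localGibbsLaw σ (fun _ => 1) (fun _ => 0) (fun _ => θe) N (Φ N) with hG_def
  haveI : IsProbabilityMeasure G :=
    isProbabilityMeasure_localGibbsLaw continuous_const continuous_const continuous_const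
      (fun _ => one_pos) (fun _ => hθe) (by linarith : σ ≤ 1 / 2) N (Φ N)
  -- the slabs: `W = ⌈τ/(K t_N)⌉` of length `ℓ = τ/W ∈ [K t_N/2, K t_N]`
  set W : ℕ := ⌈τ / ((K : ℝ) * tN)⌉₊ with hW_def
  have hWpos : 0 < W := Nat.ceil_pos.2 (div_pos hτ hKt)
  have hW0 : (0 : ℝ) < W := by exact_mod_cast hWpos
  set ℓ : ℝ := τ / W with hℓ_def
  have hℓ0 : 0 ≤ ℓ := by positivity
  have hWℓ : (W : ℝ) * ℓ = τ := by rw [hℓ_def]; field_simp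
  have hWge : τ ≤ (W : ℝ) * ((K : ℝ) * tN) := by
    have := Nat.le_ceil (τ / ((K : ℝ) * tN))
    rwa [div_le_iff₀ hKt] at this
  have hWle : (W : ℝ) * ((K : ℝ) * tN) ≤ 2 * τ := by
    have h1 : (W : ℝ) < τ / ((K : ℝ) * tN) + 1 := Nat.ceil_lt_add_one (by positivity)
    have h2 : (W : ℝ) * ((K : ℝ) * tN) < τ + (K : ℝ) * tN := by
      have := mul_lt_mul_of_pos_right h1 hKt
      rwa [add_mul, one_mul, div_mul_cancel₀ _ hKt.ne'] at this
    linarith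
  have hℓ_le : ℓ ≤ (K : ℝ) * tN := by
    rw [hℓ_def, div_le_iff₀ hW0]; linarith
  have hℓ_ge : (K : ℝ) * tN / 2 ≤ ℓ := by
    rw [hℓ_def, le_div_iff₀ hW0]; linarith
  -- the slab functionals
  set χw : ℕ → ℝ × UnitAddTorus (Fin 3) → ℝ := fun w p => χ (p.1 + (w : ℝ) * ℓ, p.2) with hχw_def
  have hχw : ∀ w, Continuous (χw w) := fun w => hχ.comp (by fun_prop)
  set Sw : ℕ → Config (N + 1) (Fin 3) T3 → ℝ := fun w z =>
    metroOddSum σ N (Φ N) (Set.Ioc 0 ℓ) (χw w) g Ψ rKN ϑ z with hSw_def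
  set f : ℕ → Config (N + 1) (Fin 3) T3 → ℝ := fun w z => b * ε * Sw w z with hf_def
  set T : ℕ → Config (N + 1) (Fin 3) T3 → Config (N + 1) (Fin 3) T3 := fun w => (Φ N).flow ((w : ℝ) * ℓ)
    with hT_def
  set gm : ℝ → Config (N + 1) (Fin 3) T3 → Fin (N + 1) → Fin (N + 1) → ℝ :=
    fun t z' i j => metroOddMark σ N χ g Ψ rKN ϑ t z' i j with hgm_def
  -- Step A: decomposition of the statistic on the complement of a null set
  set Z : Set (Config (N + 1) (Fin 3) T3) :=
    {z | (0 : ℝ) ∈ collisionTimes (Torus.geometry (Fin 3)) (hsDiameter σ N) (fun t => (Φ N).flow t z)} ∪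
      (Φ N).goodᶜ with hZ_def
  have hZ : G Z = 0 := stub_timeZeroNull hσ _ _ _ N (Φ N)
  have hdecomp : ∀ z, z ∉ Z → metroOddStat σ N (Φ N) τ χ g Ψ rKN ϑ z =
      ε / (N + 1 : ℝ) * ∑ w ∈ Finset.range W, Sw w (T w z) := by
    intro z hz
    have hzg : z ∈ (Φ N).good := by
      by_contra h; exact hz (Or.inr h)
    have hz0 : (0 : ℝ) ∉ collisionTimes (Torus.geometry (Fin 3)) (hsDiameter σ N)
        (fun t => (Φ N).flow t z) := fun h => hz (Or.inl h)
    obtain ⟨hshift, hadd, hclosed⟩ := stub_slabShiftDecomp (Φ N) gm hzg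
    rw [metroOddStat_eq, metroOddSum_eq_collisionPairSum_of_mem_good _ _ hzg]
    change ε / (N + 1 : ℝ) * (Φ N).collisionPairSum (Set.Icc 0 τ) gm z = _
    rw [hclosed hz0 τ, show Set.Ioc (0 : ℝ) τ = Set.Ioc 0 ((W : ℝ) * ℓ) by rw [hWℓ], hadd ℓ hℓ0 W]
    congr 1
    refine Finset.sum_congr rfl fun w _ => ?_
    have hTz : T w z ∈ (Φ N).good := (Φ N).mapsTo_good _ hzg
    rw [show Set.Ioc ((w : ℝ) * ℓ) (((w : ℝ) + 1) * ℓ) = Set.Ioc ((w : ℝ) * ℓ + 0) ((w : ℝ) * ℓ + ℓ) by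
      congr 1 <;> ring, hshift ((w : ℝ) * ℓ) 0 ℓ, hSw_def]
    simp only
    rw [metroOddSum_eq_collisionPairSum_of_mem_good _ _ hTz]
    rfl
  -- Step B: the event inclusion
  set c : ℝ := b * ((N : ℝ) + 1) * x with hc_def
  have hεN : 0 < ε / (N + 1 : ℝ) := div_pos hε0 hN1
  have hsub : {z | x < |metroOddStat σ N (Φ N) τ χ g Ψ rKN ϑ z|} ⊆
      Z ∪ {z | c ≤ ∑ w ∈ Finset.range W, |f w (T w z)|} := by
    intro z hz
    by_cases hzZ : z ∈ Z
    · exact Or.inl hzZ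
    right
    simp only [mem_setOf_eq] at hz ⊢
    rw [hdecomp z hzZ] at hz
    have h1 : x < ε / (N + 1 : ℝ) * ∑ w ∈ Finset.range W, |Sw w (T w z)| := by
      calc x < |ε / (N + 1 : ℝ) * ∑ w ∈ Finset.range W, Sw w (T w z)| := hz
        _ = ε / (N + 1 : ℝ) * |∑ w ∈ Finset.range W, Sw w (T w z)| := by
            rw [abs_mul, abs_of_pos hεN]
        _ ≤ ε / (N + 1 : ℝ) * ∑ w ∈ Finset.range W, |Sw w (T w z)| :=
            mul_le_mul_of_nonneg_left (Finset.abs_sum_le_sum_abs _ _) hεN.le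
    have h2 : ∑ w ∈ Finset.range W, |f w (T w z)| = b * ε * ∑ w ∈ Finset.range W, |Sw w (T w z)| := by
      rw [Finset.mul_sum]
      refine Finset.sum_congr rfl fun w _ => ?_
      rw [hf_def]
      simp only
      rw [abs_mul, abs_of_pos (mul_pos hb hε0)]
    rw [h2, hc_def]
    have h3 : ((N : ℝ) + 1) * x ≤ ε * ∑ w ∈ Finset.range W, |Sw w (T w z)| := by
      have h1' := h1
      rw [div_mul_eq_mul_div, lt_div_iff₀ hN1] at h1'
      linarith
    calc b * ((N : ℝ) + 1) * x = b * (((N : ℝ) + 1) * x) := by ring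
      _ ≤ b * (ε * ∑ w ∈ Finset.range W, |Sw w (T w z)|) := mul_le_mul_of_nonneg_left h3 hb.le
      _ = b * ε * ∑ w ∈ Finset.range W, |Sw w (T w z)| := by ring
  -- Step C: Hölder over the `G`-preserving shifts + Chernoff
  have hT : ∀ w < W, MeasurePreserving (T w) G G := fun w _ =>
    measurePreserving_flow_localGibbsLaw_const σ 1 θe 0 N (Φ N) _
  have hgood : ∀ᵐ z ∂G, z ∈ (Φ N).good := by
    have : G (Φ N).goodᶜ = 0 := measure_mono_null subset_union_right hZ
    exact mem_ae_iff.2 this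
  have hfm : ∀ w < W, AEMeasurable (f w) G := by
    intro w _
    obtain ⟨hcont, hmeas⟩ := stub_metroMarkRegular hσ hσ2 N (hχw w) hg hΨ hrKN hϑ
    obtain ⟨hIoc, -⟩ := stub_collisionPairSumMeasurable hε0 hε2 (Φ N)
      (fun t z' i j => metroOddMark σ N (χw w) g Ψ rKN ϑ t z' i j) hcont hmeas 0 ℓ
    have hae : Sw w =ᵐ[G] (Φ N).good.indicator ((Φ N).collisionPairSum (Set.Ioc 0 ℓ)
        (fun t z' i j => metroOddMark σ N (χw w) g Ψ rKN ϑ t z' i j)) := by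
      filter_upwards [hgood] with z hz
      rw [indicator_of_mem hz, hSw_def]
      exact metroOddSum_eq_collisionPairSum_of_mem_good _ _ hz
    have h1 : AEMeasurable (Sw w) G := hIoc.aemeasurable.congr hae.symm
    exact h1.const_mul (b * ε)
  set b₁ : ℝ := (W : ℝ) * (b * ε) * K with hb₁_def
  have hb₁ : b₁ = b * σ * ((W : ℝ) * ((K : ℝ) * tN)) := by rw [hb₁_def, hε]; ring
  have hb₁lo : bb / 2 ≤ b₁ := by
    rw [hb₁, hbb_def]
    have : b * σ * τ ≤ b * σ * ((W : ℝ) * ((K : ℝ) * tN)) :=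
      mul_le_mul_of_nonneg_left hWge (by positivity)
    linarith
  have hb₁hi : b₁ ≤ bb := by
    rw [hb₁, hbb_def]
    have : b * σ * ((W : ℝ) * ((K : ℝ) * tN)) ≤ b * σ * (2 * τ) :=
      mul_le_mul_of_nonneg_left hWle (by positivity)
    linarith
  set B : ℝ := b₁ * y * ((N : ℝ) + 1) with hB_def
  have hexp : ∀ w < W, ∫⁻ z, ENNReal.ofReal (Real.exp ((W : ℝ) * |f w z|)) ∂G ≤
      ENNReal.ofReal (Real.exp B) := by
    intro w hw
    have hs : (w : ℝ) * ℓ ∈ Set.Icc (0 : ℝ) τ := by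
      refine ⟨by positivity, ?_⟩
      have hwW : (w : ℝ) ≤ W := by exact_mod_cast (Finset.mem_range.1 (Finset.mem_range.2 hw)).le
      calc (w : ℝ) * ℓ ≤ (W : ℝ) * ℓ := mul_le_mul_of_nonneg_right hwW hℓ0
        _ = τ := hWℓ
    have key := hN₀ N hN₀' ((w : ℝ) * ℓ) hs ℓ hℓ_ge hℓ_le b₁ hb₁lo hb₁hi
    refine le_of_eq_of_le (lintegral_congr fun z => ?_) key
    have hz : (W : ℝ) * |f w z| = b₁ / K *
        |metroOddSum σ N (Φ N) (Set.Ioc 0 ℓ) (fun p => χ (p.1 + (w : ℝ) * ℓ, p.2)) g Ψ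
          ((K : ℝ) ^ (1 / 4 : ℝ) * ((N + 1 : ℕ) : ℝ) ^ (-(1 / 3 : ℝ))) ϑ z| := by
      rw [hf_def, hSw_def, hχw_def, hrKN_def, htN_def]
      simp only
      rw [abs_mul, abs_of_pos (mul_pos hb hε0), hb₁_def]
      field_simp
    rw [hz]
  have hHC := stub_hoelderChernoff G hWpos T hT f hfm hexp c
  -- Step D: the exponent
  have hBc : B - c ≤ -(M * ((N : ℝ) + 1)) := by
    have h1 : B ≤ bb * y * ((N : ℝ) + 1) := by
      rw [hB_def]
      exact mul_le_mul_of_nonneg_right (mul_le_mul_of_nonneg_right hb₁hi hy.le) hN1.le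
    have h2 : bb * y = b * x / 2 := by
      rw [hbb_def, hy_def]; field_simp; ring
    have h3 : b * x = 2 * M := by rw [hb_def]; field_simp
    rw [h2] at h1
    rw [hc_def]
    nlinarith
  calc G {z | x < |metroOddStat σ N (Φ N) τ χ g Ψ rKN ϑ z|}
      ≤ G (Z ∪ {z | c ≤ ∑ w ∈ Finset.range W, |f w (T w z)|}) := measure_mono hsub
    _ ≤ G Z + G {z | c ≤ ∑ w ∈ Finset.range W, |f w (T w z)|} := measure_union_le _ _
    _ ≤ 0 + ENNReal.ofReal (Real.exp (B - c)) := add_le_add hZ.le hHC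
    _ ≤ ENNReal.ofReal (Real.exp (-(M * ((N : ℝ) + 1)))) := by
        rw [zero_add]
        exact ENNReal.ofReal_le_ofReal (Real.exp_le_exp.2 hBc)

end Summit.AtomisticToContinuum.HydrodynamicLimit.Theorems.OddContactSymmetryKineticSlab

end
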